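import Summits.BirchSwinnertonDyer.BirchSwinnertonDyer.Theorems.CMKolyvaginAtInertTwoCMKolyvaginConjectureAtInertTwoNoSelmerTriggerOfTwinShaTrivial
import HarnessLib

/-!
# Route `CMKolyvaginAtInertTwo`, crux `CMKolyvaginConjectureAtInertTwo` (stmt-BirchSwinnertonDyer-24648),
# stub `stub_positiveDepth` — THE ONE-BIT LAW ON TWIN-`Ш`-TRIVIAL FRAMES (hand 10's two-bit law sharpened by one bit,
# `ε`-line removed): `Ш(E^{(d_K)}/ℚ)[2^∞] = 0 ∧ rank E^{(d_K)}(ℚ) = 0 ⟹ 2^{M₀−1} ∣ P_e(ℓ)` at EVERY deep Kolyvagin prime,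
# so at depth `M₀ ≥ 2` every deep prime-level derived point is `2`-divisible and a prime-level witness of the crux
# has `M(ℓ) < M₀`

Seat `leafhand-bsd-cmkolyvaginatinert-11` g0 (cell `bsd-eis`); helper `--supports stmt-BirchSwinnertonDyer-24648`.
THEOREMS ONLY: no definition, no named fact introduced, no `sorry`; no stub, crux or summit closed; BSD is proved
for no curve.  File 3 of this seat (file 1 `…SelmerEigenTwistedCorestriction`: `2·s = 0` for `w`-signed Selmer classes;
file 2 `…NoSelmerTriggerOfTwinShaTrivial`: no trigger at any depth, `rank E^{(d_K)}(ℚ) = 0` on the stub frame).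

WHAT.  Hands 5/6/8 attached to every deep Zhang–Kolyvagin prime `ℓ` (index `≥ L ≥ M₀`, `2^{M₀} ∣ P(1)`) and every datum `e`
the strict-descent OBSTRUCTION CLASS `s_ℓ = 2^{L−M₀}·c_L(e) ∈ Sel_{2^L}(E_K/K)` (`obstructionClass_mem_selmerGroup`, McCallum's
class `d`), `w(E)`-signed (`conjAct_obstructionClass_eq_rootNumber_smul`, Gross 5.4 (2)), of exact order `2^{M₀−m(ℓ)}` where
`2^{m(ℓ)} ∥ P_e(ℓ)` (`pow_zsmul_obstructionClass_eq_zero_iff`).  Hand 10's F3 fed `4·s_ℓ = 0` (twin-`Ш`-trivial + `ε`-line) into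
this ladder: the TWO-BIT LAW `2^{M₀−2} ∣ P_e(ℓ)`.  File 1's `2·s_ℓ = 0` gives ONE bit more, with the `ε`-line replaced by
`rank E^{(d_K)}(ℚ) = 0`:

* §1 ★ `pow_sub_one_dvd_derivedPoint_of_twinShaTrivial` — ONE-BIT LAW: `ρ̄_{E,2}` onto, odd Tamagawa; `K` imaginary quadratic,
  odd `d_K ≠ −3`, Heegner; Gross 3.7 (2) by name; `c ≠ 1`; `w(E) = −1`; `Ш(E^{(d_K)}/ℚ)[2^∞] = 0`, `rank E^{(d_K)}(ℚ) = 0`;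
  `2^{M₀} ∣ P(1)`, `1 ≤ M₀ ≤ L` ⟹ **`2^{M₀−1} ∣ P_e(ℓ)`** for every Zhang–Kolyvagin `ℓ` of index `≥ L`, every datum `e`.
  This is hand 8's §4 law (`Ш(E/K)[2^∞] = ⊥ ⟹ 2^{M₀−1} ∣ P_e(ℓ)`) under the WEAKER twin hypothesis (on `Σ ≥ 1` frames
  `Ш(E_K)[2] ≠ 0` while `Ш(E^{(d_K)})[2]` may vanish).
* §2 `two_dvd_derivedPoint_of_two_le_of_twinShaTrivial` — depth `M₀ ≥ 2` ⟹ `P_e(ℓ) ∈ 2E(K[ℓ])` for every deep `ℓ`, every `e`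
  (hand 10: `M₀ ≥ 3`); NO BSD hypothesis.
* §3 `kolyvaginIndex_lt_of_two_le_of_not_two_dvd_of_twinShaTrivial` — crux currency: at depth `M₀ ≥ 2` a prime-level witness
  `(ℓ, e)` of `CMKolyvaginConjectureAtInertTwo` (`P_e(ℓ) ∉ 2E(K[ℓ])`) has `M(ℓ) < M₀` (hand 10: `M₀ ≥ 3`).
* §4 stub currency (frame inputs → named facts `kolyvagin`, bsd.S36 parity, GZK over `ℚ`, Gross 3.7 (2)):
  ★ `exists_exactDepth_and_forall_pow_sub_one_dvd_onStubFrame_of_twinShaTrivial` (∃ exact depth `M₀ ≥ 1` with `2^{M₀−1} ∣ P_e(ℓ)`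
  at every deep `ℓ`, every `e` — hand 8 §4's shape with `Ш(E/K) = ⊥` replaced by `Ш(E^{(d_K)}/ℚ)[2^∞] = 0`),
  `kolyvaginIndex_lt_onStubFrame_of_two_le_of_not_two_dvd_of_twinShaTrivial`.

REPAIR CENSUS (as in file 2, sharpened): on (β₂) frames the first `2`-descent at a deep prime drops AT MOST ONE bit (this file)
and the Selmer trigger does not exist (file 2).  At depth `M₀ ≥ 2` a prime-level witness of the crux lives at `M(ℓ) < M₀`, i.e.
among the SHALLOW primes `ord₂(ℓ+1) < M₀` (on H₂, `a_ℓ = 0`) — the composite/shallow-level iteration (γ) is all that remains there.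
At depth `M₀ = 1` this file is empty (`2^{0} ∣ P_e(ℓ)`): a prime-level witness is a non-zero order-`2` obstruction class
`s_ℓ = c_1(e)` — Kolyvagin's non-vanishing mod `2`, OPEN, neither excluded nor produced here.  (β₁) and (δ) as before.
HONEST: helper theorems; closes nothing; BSD is proved for no curve.
References: [cite: McCallumLMS1991, §4 Cor. 4.5, §5 (Prop. 5.2, Thm. 5.4)] [cite: GrossLMS1991, Prop. 3.7 (2), §5 Prop. 5.3, 5.4 (2)]
[cite: Kramer1981, Thm. 1] [cite: Kolyvagin1990, Thm. A] [cite: WZhang2014, §3.7] [cite: Darmon2004, Thm. 3.22]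
presearch: composition of tree theorems only (files 1–2 + hands 5/6/8/10); no new query needed.
-/

set_option autoImplicit false
set_option linter.dupNamespace false -- the Theorems namespace repeats the summit name by design (D-0017)

noncomputable section
open scoped Classical
open Field NumberField IsDedekindDomain WeierstrassCurve
open Literature.NumberTheory.EllipticCurves
open Literature.NumberTheory.EllipticCurves.ModularForms
open Literature.NumberTheory.GaloisRepresentations
open Literature.NumberTheory.EllipticCurves.GrossLMS1991 (prop37_2_reductionCongruence_inert)
open Summit.BirchSwinnertonDyer.BirchSwinnertonDyer.Theorems.CMKolyvaginFirstDescentTwo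
  (obstructionClass_mem_selmerGroup conjAct_obstructionClass_eq_rootNumber_smul pow_zsmul_obstructionClass_eq_zero_iff
    exists_algEquiv_ne_one_of_isImaginaryQuadratic exists_exactDepth_pos)

namespace Summit.BirchSwinnertonDyer.BirchSwinnertonDyer.Theorems.CMKolyvaginFirstDescentTwoOnGivenFrame

variable (W : WeierstrassCurve ℚ) [W.IsElliptic] [W.IsGloballyMinimal] [NeZero (W.conductorNorm ℤ)]
  {K : Type} [Field K] [NumberField K]

/-! ## §1 ★ The one-bit law -/

/-- ★ **ONE-BIT LAW: `Ш(E^{(d_K)}/ℚ)[2^∞] = 0 ∧ rank E^{(d_K)}(ℚ) = 0 ⟹ 2^{M₀−1} ∣ P_e(ℓ)` at every deep prime.**  Frame: `W`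
globally minimal with `ρ̄_{E,2}` onto and odd Tamagawa product; `K` imaginary quadratic, odd `d_K ≠ −3`, Heegner for `N_E`; Gross
1991 Prop. 3.7 (2) at `(W, K)` by name; a conjugation `c ≠ 1`; `w(E) = −1` (binder `hw`); the twist `W.quadraticTwist d_K` with
`Ш[2^∞] = 0` (binder `hT0`) and Mordell–Weil rank `0` (binder `hTrk`); a conductor-`1` datum with `2^{M₀} ∣ P(1)`, `1 ≤ M₀ ≤ L`; `ℓ` a
Zhang–Kolyvagin prime at `2` of index `≥ L`; `e` ANY datum of conductor `ℓ`.  Then `2^{M₀−1} ∣ P_e(ℓ)`: the obstruction class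
`s_ℓ` is Selmer (hand 5) and `w(E)`-signed (hand 8), so `2·s_ℓ = 0` by file 2's `two_zsmul_eq_zero_of_selmer_eigen_of_twinShaTrivial_of_surj`
(file 1's corestriction law), and hand 6's order ladder converts.  No `ε`-line.
[cite: McCallumLMS1991, §4 Cor. 4.5, §5 (the class d, Prop. 5.2)] [cite: GrossLMS1991, Prop. 3.7 (2), §5 Prop. 5.3, 5.4 (2)]
[cite: Kramer1981, Thm. 1] -/
theorem pow_sub_one_dvd_derivedPoint_of_twinShaTrivial (hρ2 : W.HasSurjectiveModNGaloisRep 2)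
    (hT : Odd W.tamagawaProduct)
    (hK : IsImaginaryQuadratic K) (hodd : Odd (NumberField.discr K)) (h3 : NumberField.discr K ≠ -3)
    (hHe : SatisfiesHeegnerHypothesis (W.conductorNorm ℤ) K)
    (h37 : prop37_2_reductionCongruence_inert (W.conductorNorm ℤ) W K) {c : K ≃ₐ[ℚ] K} (hc : c ≠ 1)
    (hw : W.rootNumber = -1)
    (hT0 : ∀ x ∈ AddCommGroup.primaryComponent (↥(W.quadraticTwist (NumberField.discr K : ℚ)).sha) 2, x = 0)
    (hTrk : (W.quadraticTwist (NumberField.discr K : ℚ)).mordellWeilRank = 0)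
    (Dt : ModularParametrizationData W (W.conductorNorm ℤ)) (β : ℤ) (ι : K →+* ℂ)
    (d₁ : KolyvaginHeegnerData Dt β ι 1) {M₀ L : ℕ} (hM₀ : 1 ≤ M₀) (hML : M₀ ≤ L)
    (hdiv : ∃ Q : (W.baseChange (ringClassField K ι 1)).toAffine.Point,
      ((2 ^ M₀ : ℕ) : ℤ) • Q = d₁.derivedPoint)
    {ℓ : ℕ} (hKol : Zhang2014.IsKolyvaginPrime (W.conductorNorm ℤ) W K 2 ℓ)
    (hidx : L ≤ Zhang2014.kolyvaginIndex W 2 ℓ) (e : KolyvaginHeegnerData Dt β ι ℓ) :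
    ∃ Q : (W.baseChange (ringClassField K ι ℓ)).toAffine.Point, ((2 ^ (M₀ - 1) : ℕ) : ℤ) • Q = e.derivedPoint := by
  obtain ⟨hs, -, -⟩ := obstructionClass_mem_selmerGroup W hρ2 hT hK hodd h3 hHe h37 Dt β ι d₁ hML hdiv hKol hidx e
  have hL : 1 ≤ L := le_trans hM₀ hML
  have hsν := conjAct_obstructionClass_eq_rootNumber_smul W hρ2 hK hodd h3 hHe hc Dt β ι d₁ (M₀ := M₀) hL hKol hidx e
  have h2 := two_zsmul_eq_zero_of_selmer_eigen_of_twinShaTrivial_of_surj W hρ2 hK hc hT0 hTrk hw hs hsν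
  refine (pow_zsmul_obstructionClass_eq_zero_iff W hρ2 hK hodd h3 hHe Dt β ι d₁ hM₀ hML hKol hidx e).mp ?_
  rw [pow_one, Nat.cast_ofNat]
  exact h2

/-! ## §2 Depth `≥ 2`: every deep prime-level derived point is `2`-divisible -/

/-- **`Ш(E^{(d_K)}/ℚ)[2^∞] = 0`, `rank E^{(d_K)}(ℚ) = 0` and depth `M₀ ≥ 2` ⟹ `P_e(ℓ) ∈ 2E(K[ℓ])` for every deep `ℓ` and every
datum `e`.**  Same frame as §1 with `2 ≤ M₀ ≤ L`: `2^{M₀−1} ∣ P_e(ℓ)` and `M₀ − 1 ≥ 1`.  Hand 10's F3 §2 needed `M₀ ≥ 3` (and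
the `ε`-line); hand 2's deep divisibility needed BSD₂ + prints on `Σ ≥ 2`.  NO BSD hypothesis here.
[cite: McCallumLMS1991, §5 (Prop. 5.2, Thm. 5.4)] [cite: GrossLMS1991, Prop. 3.7 (2), §5 Prop. 5.3] [cite: Kramer1981, Thm. 1] -/
theorem two_dvd_derivedPoint_of_two_le_of_twinShaTrivial (hρ2 : W.HasSurjectiveModNGaloisRep 2)
    (hT : Odd W.tamagawaProduct)
    (hK : IsImaginaryQuadratic K) (hodd : Odd (NumberField.discr K)) (h3 : NumberField.discr K ≠ -3)
    (hHe : SatisfiesHeegnerHypothesis (W.conductorNorm ℤ) K)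
    (h37 : prop37_2_reductionCongruence_inert (W.conductorNorm ℤ) W K) {c : K ≃ₐ[ℚ] K} (hc : c ≠ 1)
    (hw : W.rootNumber = -1)
    (hT0 : ∀ x ∈ AddCommGroup.primaryComponent (↥(W.quadraticTwist (NumberField.discr K : ℚ)).sha) 2, x = 0)
    (hTrk : (W.quadraticTwist (NumberField.discr K : ℚ)).mordellWeilRank = 0)
    (Dt : ModularParametrizationData W (W.conductorNorm ℤ)) (β : ℤ) (ι : K →+* ℂ)
    (d₁ : KolyvaginHeegnerData Dt β ι 1) {M₀ L : ℕ} (hM₀ : 2 ≤ M₀) (hML : M₀ ≤ L)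
    (hdiv : ∃ Q : (W.baseChange (ringClassField K ι 1)).toAffine.Point,
      ((2 ^ M₀ : ℕ) : ℤ) • Q = d₁.derivedPoint)
    {ℓ : ℕ} (hKol : Zhang2014.IsKolyvaginPrime (W.conductorNorm ℤ) W K 2 ℓ)
    (hidx : L ≤ Zhang2014.kolyvaginIndex W 2 ℓ) (e : KolyvaginHeegnerData Dt β ι ℓ) :
    ∃ Q : (W.baseChange (ringClassField K ι ℓ)).toAffine.Point, (2 : ℤ) • Q = e.derivedPoint := by
  obtain ⟨Q, hQ⟩ := pow_sub_one_dvd_derivedPoint_of_twinShaTrivial W hρ2 hT hK hodd h3 hHe h37 hc hw hT0 hTrk Dt β ι d₁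
    (by omega) hML hdiv hKol hidx e
  refine ⟨(((2 : ℕ) : ℤ) ^ (M₀ - 2)) • Q, ?_⟩
  have h2 : (2 : ℤ) * (((2 : ℕ) : ℤ) ^ (M₀ - 2)) = ((2 : ℕ) : ℤ) ^ (M₀ - 1) := by
    rw [Nat.cast_ofNat, ← pow_succ', show M₀ - 2 + 1 = M₀ - 1 by omega]
  rw [smul_smul, h2, ← Nat.cast_pow]
  exact hQ

/-! ## §3 In the crux's currency: at depth `≥ 2` a prime-level witness is shallow -/

/-- **ON A TWIN-`Ш`-TRIVIAL FRAME OF DEPTH `M₀ ≥ 2` (`rank E^{(d_K)}(ℚ) = 0`), A PRIME-LEVEL WITNESS OF THE CRUX HAS KOLYVAGIN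
INDEX `< M₀`.**  Same frame as §2 with `2^{M₀} ∣ P(1)`, `M₀ ≥ 2`: if `ℓ` is a Zhang–Kolyvagin prime at `2` and some datum `e` of
conductor `ℓ` has `P_e(ℓ) ∉ 2E(K[ℓ])` (the conclusion of `CMKolyvaginConjectureAtInertTwo` at `n = ℓ`), then
`Zhang2014.kolyvaginIndex W 2 ℓ < M₀` (on H₂, `a_ℓ = 0`: `ord₂(ℓ+1) < M₀`).  Contrapositive of §2 at `L = M₀`.  Hand 10: `M₀ ≥ 3`.
[cite: McCallumLMS1991, §5 (Prop. 5.2, Thm. 5.4)] [cite: WZhang2014, §3.7 (M(ℓ), Λ)] [cite: Kramer1981, Thm. 1] -/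
theorem kolyvaginIndex_lt_of_two_le_of_not_two_dvd_of_twinShaTrivial (hρ2 : W.HasSurjectiveModNGaloisRep 2)
    (hT : Odd W.tamagawaProduct)
    (hK : IsImaginaryQuadratic K) (hodd : Odd (NumberField.discr K)) (h3 : NumberField.discr K ≠ -3)
    (hHe : SatisfiesHeegnerHypothesis (W.conductorNorm ℤ) K)
    (h37 : prop37_2_reductionCongruence_inert (W.conductorNorm ℤ) W K) {c : K ≃ₐ[ℚ] K} (hc : c ≠ 1)
    (hw : W.rootNumber = -1)
    (hT0 : ∀ x ∈ AddCommGroup.primaryComponent (↥(W.quadraticTwist (NumberField.discr K : ℚ)).sha) 2, x = 0)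
    (hTrk : (W.quadraticTwist (NumberField.discr K : ℚ)).mordellWeilRank = 0)
    (Dt : ModularParametrizationData W (W.conductorNorm ℤ)) (β : ℤ) (ι : K →+* ℂ)
    (d₁ : KolyvaginHeegnerData Dt β ι 1) {M₀ : ℕ} (hM₀ : 2 ≤ M₀)
    (hdiv : ∃ Q : (W.baseChange (ringClassField K ι 1)).toAffine.Point,
      ((2 ^ M₀ : ℕ) : ℤ) • Q = d₁.derivedPoint)
    {ℓ : ℕ} (hKol : Zhang2014.IsKolyvaginPrime (W.conductorNorm ℤ) W K 2 ℓ) (e : KolyvaginHeegnerData Dt β ι ℓ)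
    (hP : ¬ ∃ Q : (W.baseChange (ringClassField K ι ℓ)).toAffine.Point, (2 : ℤ) • Q = e.derivedPoint) :
    Zhang2014.kolyvaginIndex W 2 ℓ < M₀ := by
  by_contra hidx
  push Not at hidx
  exact hP (two_dvd_derivedPoint_of_two_le_of_twinShaTrivial W hρ2 hT hK hodd h3 hHe h37 hc hw hT0 hTrk Dt β ι d₁ hM₀
    le_rfl hdiv hKol hidx e)

/-! ## §4 In the stub's own currency (frame inputs → named facts) -/

/-- ★ **ON A TWIN-`Ш`-TRIVIAL FRAME OF `stub_positiveDepth` THE FIRST DESCENT DROPS AT MOST ONE BIT — modulo four named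
facts.**  Binders of the stub (`ρ̄_{E,2}` onto, `r_an = 1`, odd Tamagawa product; `K` imaginary quadratic with odd `d_K ≠ −3`,
Heegner for `N_E`; `Dt, β, ι`, a conductor-`1` datum `d₁` with `P(1)` of infinite order and `2 ∣ P(1)`), Gross's Prop. 3.7 (2) as
`prop37_2_reductionCongruence_inert N_E W K`, Kolyvagin's theorem as `kolyvagin N_E W K`, parity bsd.S36, Gross–Zagier–Kolyvagin
over `ℚ` as `rank_eq_analyticRank_of_analyticRank_le_one`, and `Ш(E^{(d_K)}/ℚ)[2^∞] = 0`.  Then there is an EXACT depth `M₀ ≥ 1`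
(`2^{M₀} ∥ P(1)` in `E(K[1])`) such that for every `L ≥ M₀`, every Zhang–Kolyvagin prime `ℓ` at `2` of index `≥ L` and every
datum `e` of conductor `ℓ`: **`2^{M₀−1} ∣ P_e(ℓ)` in `E(K[ℓ])`** (§1 with file 2's `quadraticTwist_mordellWeilRank_eq_zero_onStubFrame`).
Hand 10's F4 §3 had `2^{M₀−2}`; hand 8's §4 had `2^{M₀−1}` under `Ш(E/K)[2^∞] = ⊥`.
[cite: McCallumLMS1991, §5 (Prop. 5.2, Thm. 5.4)] [cite: GrossLMS1991, Prop. 3.7 (2), §5 Prop. 5.3, §1 Thm. 1.3]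
[cite: Kramer1981, Thm. 1] [cite: Darmon2004, Thm. 3.22] -/
theorem exists_exactDepth_and_forall_pow_sub_one_dvd_onStubFrame_of_twinShaTrivial
    (hρ2 : W.HasSurjectiveModNGaloisRep 2) (hr : W.analyticRank = 1) (hT : Odd W.tamagawaProduct)
    (hK : IsImaginaryQuadratic K) (hodd : Odd (NumberField.discr K)) (h3 : NumberField.discr K ≠ -3)
    (hHe : SatisfiesHeegnerHypothesis (W.conductorNorm ℤ) K)
    (h37 : prop37_2_reductionCongruence_inert (W.conductorNorm ℤ) W K)
    (hKoly : kolyvagin (W.conductorNorm ℤ) W K) (hpar : even_analyticRank_iff_rootNumber_eq_one W)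
    (hGZK : rank_eq_analyticRank_of_analyticRank_le_one)
    (hT0 : ∀ x ∈ AddCommGroup.primaryComponent (↥(W.quadraticTwist (NumberField.discr K : ℚ)).sha) 2, x = 0)
    (Dt : ModularParametrizationData W (W.conductorNorm ℤ)) (β : ℤ) (ι : K →+* ℂ)
    (d₁ : KolyvaginHeegnerData Dt β ι 1) (hy : ¬ IsOfFinAddOrder d₁.derivedPoint)
    (hpos : ∃ Q : (W.baseChange (ringClassField K ι 1)).toAffine.Point, (2 : ℤ) • Q = d₁.derivedPoint) :
    ∃ M₀ : ℕ, 1 ≤ M₀ ∧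
      (∃ Q : (W.baseChange (ringClassField K ι 1)).toAffine.Point, ((2 ^ M₀ : ℕ) : ℤ) • Q = d₁.derivedPoint) ∧
      (¬ ∃ Q : (W.baseChange (ringClassField K ι 1)).toAffine.Point,
        ((2 ^ (M₀ + 1) : ℕ) : ℤ) • Q = d₁.derivedPoint) ∧
      ∀ (L : ℕ), M₀ ≤ L → ∀ (ℓ : ℕ), Zhang2014.IsKolyvaginPrime (W.conductorNorm ℤ) W K 2 ℓ →
        L ≤ Zhang2014.kolyvaginIndex W 2 ℓ → ∀ e : KolyvaginHeegnerData Dt β ι ℓ,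
          ∃ Q : (W.baseChange (ringClassField K ι ℓ)).toAffine.Point,
            ((2 ^ (M₀ - 1) : ℕ) : ℤ) • Q = e.derivedPoint := by
  obtain ⟨c, hc⟩ := exists_algEquiv_ne_one_of_isImaginaryQuadratic hK
  have hw := rootNumber_eq_neg_one_of_analyticRank_eq_one_of_parity W hpar hr
  have hTrk := quadraticTwist_mordellWeilRank_eq_zero_onStubFrame W hr hK hHe hKoly hGZK Dt β ι d₁ hy
  obtain ⟨M₀, hM₀, hdiv, hndiv⟩ := exists_exactDepth_pos W hK Dt β ι d₁ hy hpos
  exact ⟨M₀, hM₀, hdiv, hndiv, fun L hML ℓ hKol hidx e ↦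
    pow_sub_one_dvd_derivedPoint_of_twinShaTrivial W hρ2 hT hK hodd h3 hHe h37 hc hw hT0 hTrk Dt β ι d₁ hM₀ hML hdiv
      hKol hidx e⟩

/-- **ON A TWIN-`Ш`-TRIVIAL FRAME OF `stub_positiveDepth` WITH `2^{M₀} ∣ P(1)`, `M₀ ≥ 2`, A PRIME-LEVEL WITNESS OF THE CRUX HAS
KOLYVAGIN INDEX `< M₀` — modulo the same four named facts** (§3, frame inputs discharged).  Hand 10's F4 §4: `M₀ ≥ 3`.
[cite: McCallumLMS1991, §5 (Prop. 5.2, Thm. 5.4)] [cite: WZhang2014, §3.7 (M(ℓ), Λ)] [cite: Kramer1981, Thm. 1] -/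
theorem kolyvaginIndex_lt_onStubFrame_of_two_le_of_not_two_dvd_of_twinShaTrivial
    (hρ2 : W.HasSurjectiveModNGaloisRep 2) (hr : W.analyticRank = 1) (hT : Odd W.tamagawaProduct)
    (hK : IsImaginaryQuadratic K) (hodd : Odd (NumberField.discr K)) (h3 : NumberField.discr K ≠ -3)
    (hHe : SatisfiesHeegnerHypothesis (W.conductorNorm ℤ) K)
    (h37 : prop37_2_reductionCongruence_inert (W.conductorNorm ℤ) W K)
    (hKoly : kolyvagin (W.conductorNorm ℤ) W K) (hpar : even_analyticRank_iff_rootNumber_eq_one W)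
    (hGZK : rank_eq_analyticRank_of_analyticRank_le_one)
    (hT0 : ∀ x ∈ AddCommGroup.primaryComponent (↥(W.quadraticTwist (NumberField.discr K : ℚ)).sha) 2, x = 0)
    (Dt : ModularParametrizationData W (W.conductorNorm ℤ)) (β : ℤ) (ι : K →+* ℂ)
    (d₁ : KolyvaginHeegnerData Dt β ι 1) (hy : ¬ IsOfFinAddOrder d₁.derivedPoint) {M₀ : ℕ} (hM₀ : 2 ≤ M₀)
    (hdiv : ∃ Q : (W.baseChange (ringClassField K ι 1)).toAffine.Point,
      ((2 ^ M₀ : ℕ) : ℤ) • Q = d₁.derivedPoint)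
    {ℓ : ℕ} (hKol : Zhang2014.IsKolyvaginPrime (W.conductorNorm ℤ) W K 2 ℓ) (e : KolyvaginHeegnerData Dt β ι ℓ)
    (hP : ¬ ∃ Q : (W.baseChange (ringClassField K ι ℓ)).toAffine.Point, (2 : ℤ) • Q = e.derivedPoint) :
    Zhang2014.kolyvaginIndex W 2 ℓ < M₀ := by
  obtain ⟨c, hc⟩ := exists_algEquiv_ne_one_of_isImaginaryQuadratic hK
  exact kolyvaginIndex_lt_of_two_le_of_not_two_dvd_of_twinShaTrivial W hρ2 hT hK hodd h3 hHe h37 hc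
    (rootNumber_eq_neg_one_of_analyticRank_eq_one_of_parity W hpar hr) hT0
    (quadraticTwist_mordellWeilRank_eq_zero_onStubFrame W hr hK hHe hKoly hGZK Dt β ι d₁ hy) Dt β ι d₁ hM₀ hdiv hKol e hP

end Summit.BirchSwinnertonDyer.BirchSwinnertonDyer.Theorems.CMKolyvaginFirstDescentTwoOnGivenFrame

end
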